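import Literature.NumberTheory.Automorphic.PiOfArtinRepChevalleyProofs
import Literature.NumberTheory.NumberFields.ChevalleyVUnitCongruenceProofs
import HarnessLib

/-!
# Gelbart's Prop. 4.1 (both unramified shadows) from the twisted Hecke theory of `GL(2)` alone
(pure proofs; companion to `Automorphic/PiOfArtinRepChevalleyProofs`)

`frobSatakeCompatibleAt_of_isPiOfArtinRep_both_of_chevalley` derives both named facts
`frobSatakeCompatibleAt_of_isPiOfArtinRep` (`Automorphic/StrongArtinGL2`) and
`frobSatakeCompatibleAt_of_isPiOfArtinRep_of_isUnramifiedAt`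
(`Automorphic/PiOfArtinRepAtSigmaUnramifiedPlaces`) — Gelbart 1997, Prop. 4.1 at the places where
`π`, resp. `σ`, is unramified — from two displayed hypotheses: `Chev`, Chevalley's congruence
subgroup theorem (Chevalley 1951, Thm. 1) for the `{v}`-units of a number field in
congruence-depth form, and `HT`, the twisted Hecke theory of cuspidal automorphic representations
of `GL(2)` (Jacquet–Langlands 1970, Thm. 11.1, Cor. 11.2, Thm. 2.18, Props. 3.5, 3.6, 3.8, with
the unramified dictionary).  The hypothesis `Chev` is now a **theorem of the tree**,
`NumberFields.Chevalley1951.vUnits_valuation_sub_one_le` (`NumberFields/ChevalleyVUnitCongruenceProofs`,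
Chevalley's proof for the finitely generated group `𝓞_Kˣ · π₀^ℤ`, on top of the tree's proof of
Théorème 1 for the unit group, `NumberFields.Chevalley1951.thm1_units_holds`).  This file records
the resulting reduction:

* `frobSatakeCompatibleAt_of_isPiOfArtinRep_both_of_heckeTheoryGL2` — **both named facts from
  `HT` alone**;
* `frobSatakeCompatibleAt_of_isPiOfArtinRep_of_isUnramifiedAt_of_heckeTheoryGL2` — the fact of
  `PiOfArtinRepAtSigmaUnramifiedPlaces` from `HT`.

With this, everything in Jacquet–Langlands' proof of Thm. 12.2 / Cor. 11.2 for `π = π(σ)`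
(LNM 114, pp. 209–211; = Langlands, *Base Change for GL(2)*, pp. 23–24; = Gelbart 1997,
Prop. 4.1) except the Hecke theory of `GL(2)` itself — the automorphic input `HT`, a theory of the
Borel–Jacquet automorphic representation datum `CuspidalAutomorphicRepData 2 F hcpt` which the
tree does not yet contain — is formalized: the Artin side (Brauer–Artin functional equation,
`ArtinLFunctionsRankOneMatching`), the one-place identity and its local analysis
(`PiOfArtinRepAtSigmaUnramifiedPlaces{Proofs,ArtinSideProofs,HeckeTheoryProofs}`,
`PiOfArtinRepTwistEulerFactorProofs`), the auxiliary idèle class characters of Lemma 12.5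
(`PiOfArtinRepAuxiliaryCharactersProofs`, `PiOfArtinRepChevalley{Lemmas,}Proofs`: global class
field theory of ray class characters), and Chevalley's theorem.

No definition and no named fact is introduced (D-0026).

## References

* S. Gelbart, *Three lectures on the modularity of `ρ̄_{E,3}` and the Langlands reciprocity
  conjecture*, in *Modular Forms and Fermat's Last Theorem* (1997): Prop. 4.1, Thm. 3.2,
  Example 3.2.3. [Gelbart1997]
* H. Jacquet, R. P. Langlands, *Automorphic Forms on GL(2)*, LNM 114 (1970): Thm. 11.1,
  Cor. 11.2, Lemma 12.5, proof of Thm. 12.2 (pp. 209–211). [JacquetLanglands1970]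
* R. P. Langlands, *Base Change for GL(2)*, Ann. of Math. Studies 96 (1980), pp. 23–24.
  [LanglandsBaseChange1980]
* C. Chevalley, *Deux théorèmes d'arithmétique*, J. Math. Soc. Japan 3 (1951), 36–44, Thm. 1.
  [ChevalleyDeuxTheoremes1951]
-/

noncomputable section

open scoped NumberField nonZeroDivisors
open NumberField IsDedekindDomain Field Filter Topology Set

namespace Literature.NumberTheory.Automorphic

/-- **Gelbart's Prop. 4.1 — both unramified shadows — from the twisted Hecke theory of `GL(2)`
alone.**  Hypothesis (displayed inline): `HT`, verbatim as in
`frobSatakeCompatibleAt_of_isPiOfArtinRep_both_of_heckeTheory` /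
`frobSatakeCompatibleAt_of_isPiOfArtinRep_both_of_chevalley` (Jacquet–Langlands 1970, Thm. 11.1,
Cor. 11.2, Thm. 2.18, Props. 3.5, 3.6, 3.8, with the unramified dictionary: for a cuspidal `π` on
`GL_2(𝔸_F)` and every continuous character `χ` of `Γ_F`, completed twisted `L`-functions of `π`
and its contragredient with Euler products of degree `≤ 2`, a functional equation, the unramified
local factors, triviality of the local factor under deep ramification of the twist, and
"degree `2` ⟹ unramified").  Conclusion: the named facts `frobSatakeCompatibleAt_of_isPiOfArtinRep`
and `frobSatakeCompatibleAt_of_isPiOfArtinRep_of_isUnramifiedAt` (Gelbart 1997, Prop. 4.1 at the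
places where `π`, resp. `σ`, is unramified).  Proof:
`frobSatakeCompatibleAt_of_isPiOfArtinRep_both_of_chevalley`, its hypothesis `Chev` being the
theorem `NumberFields.Chevalley1951.vUnits_valuation_sub_one_le`.
[cite: Gelbart1997, Prop. 4.1 (with Thm. 3.2 and Example 3.2.3)]
[cite: JacquetLanglands1970, Thm. 11.1, Cor. 11.2, Lemma 12.5, proof of Thm. 12.2 pp. 209–211]
[cite: ChevalleyDeuxTheoremes1951, Thm 1 (p. 36)] -/
theorem frobSatakeCompatibleAt_of_isPiOfArtinRep_both_of_heckeTheoryGL2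
    (HT : ∀ {F : Type} [Field F] [NumberField F] (hcpt : isCompact_glFiniteIntegralLevel 2 F)
      (π : CuspidalAutomorphicRepData 2 F hcpt),
      ∃ Nπ : HeightOneSpectrum (𝓞 F) → ℕ, ∀ χ : absoluteGaloisGroup F →ₜ* ℂˣ,
      ∃ (P P' : HeightOneSpectrum (𝓞 F) → Polynomial ℂ) (Λ Λ' Γ Γ' ε : ℂ → ℂ) (c : ℝ),
        (∀ u, (P u).eval 0 = 1 ∧ (P u).natDegree ≤ 2) ∧
        (∀ u, (P' u).eval 0 = 1 ∧ (P' u).natDegree ≤ 2) ∧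
        Meromorphic Λ ∧ Meromorphic Λ' ∧ Differentiable ℂ Γ ∧ Differentiable ℂ Γ' ∧
        (∃ Y : Set ℝ, Y.Finite ∧ ∀ s, Γ s = 0 → s.im ∈ Y) ∧
        (∃ Y : Set ℝ, Y.Finite ∧ ∀ s, Γ' s = 0 → s.im ∈ Y) ∧
        Continuous ε ∧ (∀ s, ε s ≠ 0) ∧ 1 ≤ c ∧
        (∀ s : ℂ, c < s.re →
          (Multipliable fun u : HeightOneSpectrum (𝓞 F) =>
              ((P u).eval ((u.residueCard : ℂ) ^ (-s)))⁻¹) ∧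
            (∀ u, (P u).eval ((u.residueCard : ℂ) ^ (-s)) ≠ 0) ∧
            Λ s * Γ s =
              ∏' u : HeightOneSpectrum (𝓞 F), ((P u).eval ((u.residueCard : ℂ) ^ (-s)))⁻¹) ∧
        (∀ s : ℂ, c < s.re →
          (Multipliable fun u : HeightOneSpectrum (𝓞 F) =>
              ((P' u).eval ((u.residueCard : ℂ) ^ (-s)))⁻¹) ∧
            (∀ u, (P' u).eval ((u.residueCard : ℂ) ^ (-s)) ≠ 0) ∧
            Λ' s * Γ' s =
              ∏' u : HeightOneSpectrum (𝓞 F), ((P' u).eval ((u.residueCard : ℂ) ^ (-s)))⁻¹) ∧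
        (∀ s, Λ s = ε s * Λ' (1 - s)) ∧
        (∀ (u : HeightOneSpectrum (𝓞 F)) (α : Multiset ℂ), π.1.HasSatakeParamAt u α →
          (∀ 𝔓 ∈ u.primesAbove, ∀ g ∈ 𝔓.inertia (absoluteGaloisGroup F), χ g = 1) →
          ∀ 𝔓 ∈ u.primesAbove, ∀ g : absoluteGaloisGroup F, IsArithFrobAt (𝓞 F) g 𝔓 →
            P u = eulerPolynomial (α.map fun a => a * (χ g : ℂ)) ∧
              P' u = eulerPolynomial (α.map fun a => a⁻¹ * (χ g : ℂ)⁻¹)) ∧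
        (∀ (u : HeightOneSpectrum (𝓞 F)) (α : Multiset ℂ), π.1.HasSatakeParamAt u α →
          (∃ 𝔓 ∈ u.primesAbove, ∃ g ∈ 𝔓.inertia (absoluteGaloisGroup F), χ g ≠ 1) →
            P u = 1 ∧ P' u = 1) ∧
        (∀ u : HeightOneSpectrum (𝓞 F),
          (∀ 𝔓 ∈ u.primesAbove, ∃ g ∈ 𝔓.inertia (absoluteGaloisGroup F),
            ∀ k : ℕ, 0 < k → k ≤ Nπ u → χ g ^ k ≠ 1) → P u = 1 ∧ P' u = 1) ∧
        (∀ u : HeightOneSpectrum (𝓞 F),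
          (∀ 𝔓 ∈ u.primesAbove, ∀ g ∈ 𝔓.inertia (absoluteGaloisGroup F), χ g = 1) →
          (∀ 𝔓 ∈ u.primesAbove, ∀ g : absoluteGaloisGroup F,
            IsArithFrobAt (𝓞 F) g 𝔓 → χ g = 1) →
          (P u).natDegree = 2 →
            ∃ B : Multiset ℂ, (0 : ℂ) ∉ B ∧ P u = eulerPolynomial B ∧
              π.1.HasSatakeParamAt u B)) :
    frobSatakeCompatibleAt_of_isPiOfArtinRep ∧
      frobSatakeCompatibleAt_of_isPiOfArtinRep_of_isUnramifiedAt :=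
  frobSatakeCompatibleAt_of_isPiOfArtinRep_both_of_chevalley
    (fun v w hwv S₀ m => NumberFields.Chevalley1951.vUnits_valuation_sub_one_le v w hwv S₀ m) HT

/-- **Gelbart's Prop. 4.1, σ-unramified shadow (the named fact
`frobSatakeCompatibleAt_of_isPiOfArtinRep_of_isUnramifiedAt`), from the twisted Hecke theory of
`GL(2)` alone**: the second component of
`frobSatakeCompatibleAt_of_isPiOfArtinRep_both_of_heckeTheoryGL2`.
[cite: Gelbart1997, Prop. 4.1 (with Thm. 3.2 and Example 3.2.3)]
[cite: JacquetLanglands1970, Thm. 11.1, Cor. 11.2, Lemma 12.5, proof of Thm. 12.2 pp. 209–211] -/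
theorem frobSatakeCompatibleAt_of_isPiOfArtinRep_of_isUnramifiedAt_of_heckeTheoryGL2
    (HT : ∀ {F : Type} [Field F] [NumberField F] (hcpt : isCompact_glFiniteIntegralLevel 2 F)
      (π : CuspidalAutomorphicRepData 2 F hcpt),
      ∃ Nπ : HeightOneSpectrum (𝓞 F) → ℕ, ∀ χ : absoluteGaloisGroup F →ₜ* ℂˣ,
      ∃ (P P' : HeightOneSpectrum (𝓞 F) → Polynomial ℂ) (Λ Λ' Γ Γ' ε : ℂ → ℂ) (c : ℝ),
        (∀ u, (P u).eval 0 = 1 ∧ (P u).natDegree ≤ 2) ∧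
        (∀ u, (P' u).eval 0 = 1 ∧ (P' u).natDegree ≤ 2) ∧
        Meromorphic Λ ∧ Meromorphic Λ' ∧ Differentiable ℂ Γ ∧ Differentiable ℂ Γ' ∧
        (∃ Y : Set ℝ, Y.Finite ∧ ∀ s, Γ s = 0 → s.im ∈ Y) ∧
        (∃ Y : Set ℝ, Y.Finite ∧ ∀ s, Γ' s = 0 → s.im ∈ Y) ∧
        Continuous ε ∧ (∀ s, ε s ≠ 0) ∧ 1 ≤ c ∧
        (∀ s : ℂ, c < s.re →
          (Multipliable fun u : HeightOneSpectrum (𝓞 F) =>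
              ((P u).eval ((u.residueCard : ℂ) ^ (-s)))⁻¹) ∧
            (∀ u, (P u).eval ((u.residueCard : ℂ) ^ (-s)) ≠ 0) ∧
            Λ s * Γ s =
              ∏' u : HeightOneSpectrum (𝓞 F), ((P u).eval ((u.residueCard : ℂ) ^ (-s)))⁻¹) ∧
        (∀ s : ℂ, c < s.re →
          (Multipliable fun u : HeightOneSpectrum (𝓞 F) =>
              ((P' u).eval ((u.residueCard : ℂ) ^ (-s)))⁻¹) ∧
            (∀ u, (P' u).eval ((u.residueCard : ℂ) ^ (-s)) ≠ 0) ∧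
            Λ' s * Γ' s =
              ∏' u : HeightOneSpectrum (𝓞 F), ((P' u).eval ((u.residueCard : ℂ) ^ (-s)))⁻¹) ∧
        (∀ s, Λ s = ε s * Λ' (1 - s)) ∧
        (∀ (u : HeightOneSpectrum (𝓞 F)) (α : Multiset ℂ), π.1.HasSatakeParamAt u α →
          (∀ 𝔓 ∈ u.primesAbove, ∀ g ∈ 𝔓.inertia (absoluteGaloisGroup F), χ g = 1) →
          ∀ 𝔓 ∈ u.primesAbove, ∀ g : absoluteGaloisGroup F, IsArithFrobAt (𝓞 F) g 𝔓 →
            P u = eulerPolynomial (α.map fun a => a * (χ g : ℂ)) ∧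
              P' u = eulerPolynomial (α.map fun a => a⁻¹ * (χ g : ℂ)⁻¹)) ∧
        (∀ (u : HeightOneSpectrum (𝓞 F)) (α : Multiset ℂ), π.1.HasSatakeParamAt u α →
          (∃ 𝔓 ∈ u.primesAbove, ∃ g ∈ 𝔓.inertia (absoluteGaloisGroup F), χ g ≠ 1) →
            P u = 1 ∧ P' u = 1) ∧
        (∀ u : HeightOneSpectrum (𝓞 F),
          (∀ 𝔓 ∈ u.primesAbove, ∃ g ∈ 𝔓.inertia (absoluteGaloisGroup F),
            ∀ k : ℕ, 0 < k → k ≤ Nπ u → χ g ^ k ≠ 1) → P u = 1 ∧ P' u = 1) ∧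
        (∀ u : HeightOneSpectrum (𝓞 F),
          (∀ 𝔓 ∈ u.primesAbove, ∀ g ∈ 𝔓.inertia (absoluteGaloisGroup F), χ g = 1) →
          (∀ 𝔓 ∈ u.primesAbove, ∀ g : absoluteGaloisGroup F,
            IsArithFrobAt (𝓞 F) g 𝔓 → χ g = 1) →
          (P u).natDegree = 2 →
            ∃ B : Multiset ℂ, (0 : ℂ) ∉ B ∧ P u = eulerPolynomial B ∧
              π.1.HasSatakeParamAt u B)) :
    frobSatakeCompatibleAt_of_isPiOfArtinRep_of_isUnramifiedAt :=
  (frobSatakeCompatibleAt_of_isPiOfArtinRep_both_of_heckeTheoryGL2 HT).2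

/-- **Gelbart's Prop. 4.1, π-unramified shadow (the named fact
`frobSatakeCompatibleAt_of_isPiOfArtinRep` of `Automorphic/StrongArtinGL2`), from the twisted
Hecke theory of `GL(2)` alone**: the first component of
`frobSatakeCompatibleAt_of_isPiOfArtinRep_both_of_heckeTheoryGL2`.
[cite: Gelbart1997, Prop. 4.1] [cite: JacquetLanglands1970, Thm. 11.1, Cor. 11.2, proof of Thm. 12.2] -/
theorem frobSatakeCompatibleAt_of_isPiOfArtinRep_of_heckeTheoryGL2
    (HT : ∀ {F : Type} [Field F] [NumberField F] (hcpt : isCompact_glFiniteIntegralLevel 2 F)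
      (π : CuspidalAutomorphicRepData 2 F hcpt),
      ∃ Nπ : HeightOneSpectrum (𝓞 F) → ℕ, ∀ χ : absoluteGaloisGroup F →ₜ* ℂˣ,
      ∃ (P P' : HeightOneSpectrum (𝓞 F) → Polynomial ℂ) (Λ Λ' Γ Γ' ε : ℂ → ℂ) (c : ℝ),
        (∀ u, (P u).eval 0 = 1 ∧ (P u).natDegree ≤ 2) ∧
        (∀ u, (P' u).eval 0 = 1 ∧ (P' u).natDegree ≤ 2) ∧
        Meromorphic Λ ∧ Meromorphic Λ' ∧ Differentiable ℂ Γ ∧ Differentiable ℂ Γ' ∧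
        (∃ Y : Set ℝ, Y.Finite ∧ ∀ s, Γ s = 0 → s.im ∈ Y) ∧
        (∃ Y : Set ℝ, Y.Finite ∧ ∀ s, Γ' s = 0 → s.im ∈ Y) ∧
        Continuous ε ∧ (∀ s, ε s ≠ 0) ∧ 1 ≤ c ∧
        (∀ s : ℂ, c < s.re →
          (Multipliable fun u : HeightOneSpectrum (𝓞 F) =>
              ((P u).eval ((u.residueCard : ℂ) ^ (-s)))⁻¹) ∧
            (∀ u, (P u).eval ((u.residueCard : ℂ) ^ (-s)) ≠ 0) ∧
            Λ s * Γ s =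
              ∏' u : HeightOneSpectrum (𝓞 F), ((P u).eval ((u.residueCard : ℂ) ^ (-s)))⁻¹) ∧
        (∀ s : ℂ, c < s.re →
          (Multipliable fun u : HeightOneSpectrum (𝓞 F) =>
              ((P' u).eval ((u.residueCard : ℂ) ^ (-s)))⁻¹) ∧
            (∀ u, (P' u).eval ((u.residueCard : ℂ) ^ (-s)) ≠ 0) ∧
            Λ' s * Γ' s =
              ∏' u : HeightOneSpectrum (𝓞 F), ((P' u).eval ((u.residueCard : ℂ) ^ (-s)))⁻¹) ∧
        (∀ s, Λ s = ε s * Λ' (1 - s)) ∧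
        (∀ (u : HeightOneSpectrum (𝓞 F)) (α : Multiset ℂ), π.1.HasSatakeParamAt u α →
          (∀ 𝔓 ∈ u.primesAbove, ∀ g ∈ 𝔓.inertia (absoluteGaloisGroup F), χ g = 1) →
          ∀ 𝔓 ∈ u.primesAbove, ∀ g : absoluteGaloisGroup F, IsArithFrobAt (𝓞 F) g 𝔓 →
            P u = eulerPolynomial (α.map fun a => a * (χ g : ℂ)) ∧
              P' u = eulerPolynomial (α.map fun a => a⁻¹ * (χ g : ℂ)⁻¹)) ∧
        (∀ (u : HeightOneSpectrum (𝓞 F)) (α : Multiset ℂ), π.1.HasSatakeParamAt u α →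
          (∃ 𝔓 ∈ u.primesAbove, ∃ g ∈ 𝔓.inertia (absoluteGaloisGroup F), χ g ≠ 1) →
            P u = 1 ∧ P' u = 1) ∧
        (∀ u : HeightOneSpectrum (𝓞 F),
          (∀ 𝔓 ∈ u.primesAbove, ∃ g ∈ 𝔓.inertia (absoluteGaloisGroup F),
            ∀ k : ℕ, 0 < k → k ≤ Nπ u → χ g ^ k ≠ 1) → P u = 1 ∧ P' u = 1) ∧
        (∀ u : HeightOneSpectrum (𝓞 F),
          (∀ 𝔓 ∈ u.primesAbove, ∀ g ∈ 𝔓.inertia (absoluteGaloisGroup F), χ g = 1) →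
          (∀ 𝔓 ∈ u.primesAbove, ∀ g : absoluteGaloisGroup F,
            IsArithFrobAt (𝓞 F) g 𝔓 → χ g = 1) →
          (P u).natDegree = 2 →
            ∃ B : Multiset ℂ, (0 : ℂ) ∉ B ∧ P u = eulerPolynomial B ∧
              π.1.HasSatakeParamAt u B)) :
    frobSatakeCompatibleAt_of_isPiOfArtinRep :=
  (frobSatakeCompatibleAt_of_isPiOfArtinRep_both_of_heckeTheoryGL2 HT).1

end Literature.NumberTheory.Automorphic

end
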